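import Mathlib
import Literature.Analysis.Fourier.DiscreteCantorFUPProofs
import HarnessLib

/-!
# The discrete Fourier transform and its properties
(Davis–Rabinowitz 1984, Sect. 3.9.5.3, (3.1)–(3.4), (3.11)–(3.17), (3.21))

**Source.** P. J. Davis, P. Rabinowitz, *Methods of Numerical Integration* (2nd ed., Academic Press, 1984),
Sect. 3.9.5 "The Discrete Fourier Transform and Fast Fourier Transform Methods", 3.9.5.3 "The DFT and
its Properties" (pp. 245–250).

**Statement.** For the DFT `G(r) = Σ_{k=0}^{N-1} g(k) w^{rk}`, `w = e^{2πi/N}` (3.1), the text records: the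
orthogonality relation `Σ_r w^{r(j-k)} = N δ_{jk}` (3.2); the inversion formula `g(k) = N⁻¹ Σ_r G(r) w^{-kr}`
(3.3)–(3.4); Parseval's theorem `G*H = N g*h` (3.11) and `‖G‖² = N ‖g‖²` (3.12); the shift theorem
`G_k(r) = w^{-kr} G(r)` for `g_k(j) = g(j+k)` (3.13)–(3.14); Hermitian symmetry of the transform of a real
vector (3.15); the transform of the first difference `Δg ↦ (w^{-r} - 1) G(r)` (3.16)–(3.17); and the
convolution theorem — circulants are diagonalised by the DFT, i.e. the transform of a cyclic convolution is
the product of the transforms (3.21).  We prove all of these for Mathlib's `ZMod.dft` (notation `𝓕`), which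
is the transform on `ℤ/Nℤ` with kernel `stdAddChar (-(j k)) = e^{-2πi jk/N}`, i.e. the text's `D` with `w`
replaced by `w̄ = w⁻¹` (the opposite, equally common, sign convention): every factor `w^{m}` of the text
appears here as `stdAddChar (-m)`, and conversely.  The orthogonality relation (3.2), the unit modulus of the
kernel, Plancherel (3.12) and the shift theorem (3.14) are ALREADY in the tree, proved for the Dyatlov–Jin
fractal uncertainty file: `Literature.Analysis.Fourier.sum_stdAddChar_mul`, `….conj_stdAddChar`,
`….sum_norm_sq_dft`, `….dft_comp_add_right` (`Literature/Analysis/Fourier/DiscreteCantorFUPProofs.lean`) —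
reused here, not re-proved; this file adds the remaining items of the text's list.

**Used by / context.** These identities are what make the FFT route to Fourier integrals and to discrete
convolutions (Sect. 3.9.5.5) work; Mathlib supplies the transform, its linearity and the inversion formula
`ZMod.dft_dft`, the tree supplies orthogonality / Plancherel / shift, and this file adds the inversion
formula in the text's form, the full (sesquilinear) Parseval identity, the difference theorem, both halves
of the Hermitian-symmetry statement and the convolution theorem for the cyclic convolution `cyclicConv`.

**Proof sketch / formalization notes.** `conj (stdAddChar j) = stdAddChar (-j)` (tree) gives
`conj (𝓕Φ k) = Σ_j stdAddChar (jk) conj(Φ j)` (`conj_dft_apply`), from which both symmetry statements are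
immediate (the second after the reindexing `j ↦ -j`) and Parseval follows by one exchange of sums and the
inversion formula `𝓕 (𝓕 Ψ) (-j) = N Ψ j` (`ZMod.dft_dft`); the difference and convolution theorems follow
from the tree's shift theorem and linearity.  No `sorry`, no new axioms.
-/

open Finset Complex ZMod

noncomputable section

namespace Literature.Analysis.Quadrature

variable {N : ℕ} [NeZero N]

/-- **Inversion formula** (Davis–Rabinowitz (3.3)–(3.4)), for Mathlib's transform:
`Φ k = N⁻¹ Σ_r e^{2πi rk/N} (𝓕Φ)(r)`. [cite: DavisRabinowitz1984, Sect. 3.9.5.3 (3.3)-(3.4)] -/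
theorem dft_inversion (Φ : ZMod N → ℂ) (k : ZMod N) :
    Φ k = (N : ℂ)⁻¹ * ∑ r : ZMod N, stdAddChar (r * k) * 𝓕 Φ r := by
  have h := invDFT_apply (𝓕 Φ) k
  rw [LinearEquiv.symm_apply_apply] at h
  simpa [smul_eq_mul] using h

/-- The conjugate of a DFT value: `conj ((𝓕Φ) k) = Σ_j e^{2πi jk/N} conj (Φ j)`.
[cite: DavisRabinowitz1984, Sect. 3.9.5.3 (3.10)-(3.11)] -/
theorem conj_dft_apply (Φ : ZMod N → ℂ) (k : ZMod N) :
    starRingEnd ℂ (𝓕 Φ k) = ∑ j : ZMod N, stdAddChar (j * k) * starRingEnd ℂ (Φ j) := by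
  rw [dft_apply, map_sum]
  refine sum_congr rfl fun j _ => ?_
  rw [smul_eq_mul, map_mul, _root_.Literature.Analysis.Fourier.conj_stdAddChar, neg_neg]

/-- **Parseval's theorem** (Davis–Rabinowitz (3.11)): `Σ_k conj((𝓕Φ) k) (𝓕Ψ)(k) = N Σ_j conj(Φ j) Ψ j`,
i.e. `G*H = N g*h`. [cite: DavisRabinowitz1984, Sect. 3.9.5.3 (3.11)] -/
theorem dft_parseval (Φ Ψ : ZMod N → ℂ) :
    ∑ k : ZMod N, starRingEnd ℂ (𝓕 Φ k) * 𝓕 Ψ k = (N : ℂ) * ∑ j : ZMod N, starRingEnd ℂ (Φ j) * Ψ j := by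
  have hinv : ∀ j : ZMod N, ∑ k : ZMod N, stdAddChar (j * k) * 𝓕 Ψ k = (N : ℂ) * Ψ j := by
    intro j
    have h := congrFun (dft_dft Ψ) (-j)
    rw [dft_apply] at h
    simp only [neg_neg, smul_eq_mul] at h
    rw [← h]
    refine sum_congr rfl fun k _ => ?_
    congr 2
    ring
  calc ∑ k : ZMod N, starRingEnd ℂ (𝓕 Φ k) * 𝓕 Ψ k
      = ∑ k : ZMod N, ∑ j : ZMod N, stdAddChar (j * k) * starRingEnd ℂ (Φ j) * 𝓕 Ψ k := by
        refine sum_congr rfl fun k _ => ?_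
        rw [conj_dft_apply, sum_mul]
    _ = ∑ j : ZMod N, starRingEnd ℂ (Φ j) * ∑ k : ZMod N, stdAddChar (j * k) * 𝓕 Ψ k := by
        rw [sum_comm]
        refine sum_congr rfl fun j _ => ?_
        rw [mul_sum]
        refine sum_congr rfl fun k _ => ?_
        ring
    _ = (N : ℂ) * ∑ j : ZMod N, starRingEnd ℂ (Φ j) * Ψ j := by
        rw [mul_sum]
        refine sum_congr rfl fun j _ => ?_
        rw [hinv j]
        ring

/-- **Transform of the first difference** (Davis–Rabinowitz (3.16)–(3.17)):
`𝓕(j ↦ Φ(j+1) - Φ(j))(k) = (e^{2πi k/N} - 1) (𝓕Φ)(k)`. [cite: DavisRabinowitz1984, Sect. 3.9.5.3 (3.16)-(3.17)] -/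
theorem dft_forward_difference (Φ : ZMod N → ℂ) (k : ZMod N) :
    𝓕 (fun j => Φ (j + 1) - Φ j) k = (stdAddChar k - 1) * 𝓕 Φ k := by
  have h : (fun j => Φ (j + 1) - Φ j) = (fun j => Φ (j + 1)) - Φ := rfl
  rw [h, map_sub, Pi.sub_apply, _root_.Literature.Analysis.Fourier.dft_comp_add_right, one_mul, sub_mul, one_mul]

/-- **Hermitian symmetry** (Davis–Rabinowitz (3.15)): the transform of a real vector satisfies
`conj ((𝓕Φ) k) = (𝓕Φ)(-k)`. [cite: DavisRabinowitz1984, Sect. 3.9.5.3 (3.15)] -/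
theorem dft_conj_symm_of_real {Φ : ZMod N → ℂ} (hΦ : ∀ j, starRingEnd ℂ (Φ j) = Φ j) (k : ZMod N) :
    starRingEnd ℂ (𝓕 Φ k) = 𝓕 Φ (-k) := by
  rw [conj_dft_apply, dft_apply]
  refine sum_congr rfl fun j _ => ?_
  rw [hΦ j, smul_eq_mul, mul_neg, neg_neg]

/-- **Hermitian symmetry, converse half** (Davis–Rabinowitz (3.15) and the sentence after it): a
conjugate-symmetric vector, `conj (Φ j) = Φ(-j)`, has a real transform, `conj ((𝓕Φ) k) = (𝓕Φ)(k)`.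
[cite: DavisRabinowitz1984, Sect. 3.9.5.3 (3.15)] -/
theorem dft_real_of_conj_symm {Φ : ZMod N → ℂ} (hΦ : ∀ j, starRingEnd ℂ (Φ j) = Φ (-j)) (k : ZMod N) :
    starRingEnd ℂ (𝓕 Φ k) = 𝓕 Φ k := by
  rw [conj_dft_apply, dft_apply]
  rw [← Equiv.sum_comp (Equiv.neg (ZMod N)) (fun j : ZMod N => stdAddChar (-(j * k)) • Φ j)]
  refine sum_congr rfl fun j _ => ?_
  simp only [Equiv.neg_apply, smul_eq_mul, hΦ j, neg_mul, neg_neg]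

/-- The cyclic (period-`N`) convolution `(Φ ⋆ Ψ)(k) = Σ_j Φ(j) Ψ(k - j)` on `ℤ/Nℤ` — the product of the
circulant generated by `Ψ` with `Φ` (Davis–Rabinowitz (3.21)–(3.25)).
[cite: DavisRabinowitz1984, Sect. 3.9.5.3 (3.21)] -/
def cyclicConv (Φ Ψ : ZMod N → ℂ) (k : ZMod N) : ℂ := ∑ j : ZMod N, Φ j * Ψ (k - j)

/-- **Convolution theorem** (Davis–Rabinowitz (3.21): circulants are diagonalised by the DFT): the transform
of a cyclic convolution is the pointwise product of the transforms, `𝓕(Φ ⋆ Ψ) = 𝓕Φ · 𝓕Ψ`.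
[cite: DavisRabinowitz1984, Sect. 3.9.5.3 (3.21)] -/
theorem dft_cyclicConv (Φ Ψ : ZMod N → ℂ) (k : ZMod N) :
    𝓕 (cyclicConv Φ Ψ) k = 𝓕 Φ k * 𝓕 Ψ k := by
  have hshift : ∀ j : ZMod N, ∑ m : ZMod N, stdAddChar (-(m * k)) * Ψ (m - j)
      = stdAddChar (-(j * k)) * 𝓕 Ψ k := by
    intro j
    have h := _root_.Literature.Analysis.Fourier.dft_comp_add_right Ψ (-j) k
    rw [dft_apply] at h
    simp only [smul_eq_mul, ← sub_eq_add_neg, neg_mul] at h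
    simpa [neg_mul] using h
  unfold cyclicConv
  rw [dft_apply, dft_apply]
  simp only [smul_eq_mul, mul_sum, sum_mul]
  rw [sum_comm]
  refine sum_congr rfl fun j _ => ?_
  calc ∑ m : ZMod N, stdAddChar (-(m * k)) * (Φ j * Ψ (m - j))
      = Φ j * ∑ m : ZMod N, stdAddChar (-(m * k)) * Ψ (m - j) := by
        rw [mul_sum]
        refine sum_congr rfl fun m _ => ?_
        ring
    _ = stdAddChar (-(j * k)) * Φ j * 𝓕 Ψ k := by
        rw [hshift j]
        ring

/-- The cyclic convolution is commutative. [cite: DavisRabinowitz1984, Sect. 3.9.5.3 (3.18)-(3.21)] -/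
theorem cyclicConv_comm (Φ Ψ : ZMod N → ℂ) : cyclicConv Φ Ψ = cyclicConv Ψ Φ := by
  funext k
  unfold cyclicConv
  rw [← Equiv.sum_comp (Equiv.subLeft k) (fun j : ZMod N => Ψ j * Φ (k - j))]
  refine sum_congr rfl fun j _ => ?_
  simp only [Equiv.subLeft_apply, sub_sub_cancel]
  ring

end Literature.Analysis.Quadrature

end
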